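import Summits.CriticalPhenomena.PercolationContinuityZ3.Theorems.SahiMasterFamilyFCombOneSharedDict

/-!
# SCHEME Σ: the column Kleitman–Hall classes (S1), (S2) of `φ` (support file)

Support file (prover seat `prim-bnk-2`, gen 31–32; `--supports stmt-CriticalPhenomena-4575`).  Proof document
`run/shared/lean/prim/prim-l12/prim-bnk-2/PROOF-THEOREM-I1.md` §2 (✓adm) and §3 (injectivity).

(S1): a `T1⁻` unit `((x, y), 0)` with `e ∈ y` has `x_I ∈ L(B⁰|_R)` (`dom_S1`) and goes to the `T1⁺` unit at
`(g₀(x_I) ∪ x_J, y)` (`phi_eq_S1`); (S2): a `T2⁻` unit with `e ∈ y` has `x_J ∈ L(C⁰|_{J \ w})` and goes to the `T2⁺` unit at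
`(x_I ∪ h₀(x_J), y)`.  For each class: the target is a positive unit at a dominating face (`phi_adm_S1`, `phi_adm_S2`), its
signature (`sig_phi_S1 = 1`, `sig_phi_S2 = 2`), and `φ` is injective on the class (`inj_S1`, `inj_S2`: the column is that of the
target and the Kleitman–Hall bijection is injective).  No definitions; no `sorry`.
-/

namespace Summit.CriticalPhenomena.PercolationContinuityZ3.Theorems

namespace SahiFComb.Shift

open Finset FinsetFamily
open scoped Classical

variable {ι : Type*} [Fintype ι] [DecidableEq ι] [LinearOrder ι]

namespace OneShared

variable {S : OneShared ι}

/-! ### Class (S1): `T1⁻` with `e ∈ y` -/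

/-- (S1) domain: `x_I ∈ σP \ P` for `P = B⁰|_R`, `R = I \ (y ∩ I)`. [this work] -/
theorem dom_S1 {x y : Finset ι} (hu : ((x, y), 0) ∈ ThreePartition.negUnitSetF S.B S.C) (hey : S.e ∈ y) :
    x ∩ S.I ∈ (secLow (S.I \ (y ∩ S.I)) S.B).image (fun t => (S.I \ (y ∩ S.I)) \ t) \ secLow (S.I \ (y ∩ S.I)) S.B := by
  rw [mem_negUnitSetF_iff] at hu
  obtain ⟨hxy, h⟩ := hu
  simp only at hxy h
  rcases h with ⟨-, ⟨-, hxB⟩, hzB⟩ | ⟨h1, -⟩ | ⟨h2, -⟩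
  rotate_left
  · exact absurd h1 (by norm_num)
  · exact absurd h2 (by norm_num)
  have hex : S.e ∉ x := fun h => disjoint_left.1 hxy h hey
  have hxIR : x ∩ S.I ⊆ S.I \ (y ∩ S.I) := inter_subset_sdiff_inter hxy S.I
  have hzI : (x ∪ y)ᶜ ∩ S.I = (S.I \ (y ∩ S.I)) \ (x ∩ S.I) := compl_union_inter_eq x y S.I
  have hez : S.e ∉ (x ∪ y)ᶜ := by rw [mem_compl, not_not, mem_union]; exact Or.inr hey
  have hPR : ∀ s ∈ secLow (S.I \ (y ∩ S.I)) S.B, s ⊆ S.I \ (y ∩ S.I) := fun s hs => (mem_secLow.1 hs).1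
  rw [mem_sdiff, mem_image_ground_sdiff _ hPR]
  refine ⟨⟨hxIR, ?_⟩, fun h => hxB ((mem_B_iff_secLow hex hxIR).2 h)⟩
  rw [← hzI]
  exact (mem_B_iff_secLow hez (hzI ▸ sdiff_subset)).1 hzB

/-- (S1) the value of `φ`. [this work] -/
theorem phi_eq_S1 {x y : Finset ι} (hu : ((x, y), 0) ∈ ThreePartition.negUnitSetF S.B S.C) (hey : S.e ∈ y) :
    S.phi ((x, y), 0) = (((x \ S.I) ∪ ((S.dataI y).g₀ ⟨x ∩ S.I, dom_S1 hu hey⟩ : Finset ι), y), 0) := by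
  unfold OneShared.phi
  simp only [hey, if_true]
  rw [dif_pos (dom_S1 hu hey)]

/-- (S1) the new `I`-trace `g = g₀(x_I)` lies in `H(P) = P \ σP`; in particular `g ⊆ R`. [this work] -/
theorem img_S1 {x y : Finset ι} (hu : ((x, y), 0) ∈ ThreePartition.negUnitSetF S.B S.C) (hey : S.e ∈ y) :
    ((S.dataI y).g₀ ⟨x ∩ S.I, dom_S1 hu hey⟩ : Finset ι) ⊆ S.I \ (y ∩ S.I) ∧
      ((S.dataI y).g₀ ⟨x ∩ S.I, dom_S1 hu hey⟩ : Finset ι) ∈ S.B ∧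
      (S.I \ (y ∩ S.I)) \ ((S.dataI y).g₀ ⟨x ∩ S.I, dom_S1 hu hey⟩ : Finset ι) ∉ secLow (S.I \ (y ∩ S.I)) S.B := by
  have hPR : ∀ s ∈ secLow (S.I \ (y ∩ S.I)) S.B, s ⊆ S.I \ (y ∩ S.I) := fun s hs => (mem_secLow.1 hs).1
  have hgmem := ((S.dataI y).g₀ ⟨x ∩ S.I, dom_S1 hu hey⟩).2
  rw [mem_sdiff, mem_image_ground_sdiff _ hPR, mem_secLow] at hgmem
  obtain ⟨⟨hgR, hgB⟩, hgn⟩ := hgmem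
  exact ⟨hgR, hgB, fun h => hgn ⟨hgR, h⟩⟩

/-- **Class (S1)** (`T1⁻` with `e ∈ y`): `φ` sends it to the `T1⁺` unit at `(g₀(x_I) ∪ x_J, y)`, which dominates it. [this work] -/
theorem phi_adm_S1 {x y : Finset ι} (hu : ((x, y), 0) ∈ ThreePartition.negUnitSetF S.B S.C) (hey : S.e ∈ y) :
    S.phi ((x, y), 0) ∈ ThreePartition.posUnitSetF S.B S.C ∧ x ⊆ (S.phi ((x, y), 0)).1.1 ∧ y ⊆ (S.phi ((x, y), 0)).1.2 := by
  obtain ⟨hgR, hgB, hgn⟩ := img_S1 hu hey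
  have hgdom : x ∩ S.I ⊆ ((S.dataI y).g₀ ⟨x ∩ S.I, dom_S1 hu hey⟩ : Finset ι) :=
    (S.dataI y).hg₀ ⟨x ∩ S.I, dom_S1 hu hey⟩
  rw [phi_eq_S1 hu hey]
  set g := ((S.dataI y).g₀ ⟨x ∩ S.I, dom_S1 hu hey⟩ : Finset ι) with hg
  rw [mem_negUnitSetF_iff] at hu
  obtain ⟨hxy, h⟩ := hu
  simp only at hxy h
  rcases h with ⟨-, ⟨hxC, -⟩, -⟩ | ⟨h1, -⟩ | ⟨h2, -⟩
  rotate_left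
  · exact absurd h1 (by norm_num)
  · exact absurd h2 (by norm_num)
  have hex : S.e ∉ x := fun h => disjoint_left.1 hxy h hey
  have hgI : g ⊆ S.I := hgR.trans sdiff_subset
  have hex' : S.e ∉ (x \ S.I) ∪ g := fun h => hex ((nf_mem_iff S.heI hgI).1 h)
  have hdisj' : Disjoint ((x \ S.I) ∪ g) y := nf_disjoint hxy hgR
  have hez' : S.e ∉ (((x \ S.I) ∪ g) ∪ y)ᶜ := by rw [mem_compl, not_not, mem_union]; exact Or.inr hey
  rw [mem_posUnitSetF_iff]
  refine ⟨⟨hdisj', Or.inl ⟨rfl, ⟨?_, ?_⟩, ?_⟩⟩, nf_subset hgdom, subset_rfl⟩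
  · -- `x' ∈ B`
    refine (mem_B_iff_secLow (R := S.I \ (y ∩ S.I)) hex' ?_).2 ?_
    · rw [nf_inter hgI]; exact hgR
    · rw [nf_inter hgI]; exact mem_secLow.2 ⟨hgR, hgB⟩
  · -- `x' ∈ C` (its `J`-trace is that of `x`)
    have hxJ : x ∩ S.J ∈ secLow (S.J \ (y ∩ S.J)) S.C :=
      (mem_C_iff_secLow hex (inter_subset_sdiff_inter hxy S.J)).1 hxC
    refine (mem_C_iff_secLow hex' (inter_subset_sdiff_inter hdisj' S.J)).2 ?_
    rw [nf_inter_other S.hIJ hgI]; exact hxJ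
  · -- `z' ∉ B`
    intro hz'B
    have hz'I : (((x \ S.I) ∪ g) ∪ y)ᶜ ∩ S.I = (S.I \ (y ∩ S.I)) \ g := nf_compl_inter hgI
    have h1 := (mem_B_iff_secLow hez' (hz'I ▸ sdiff_subset)).1 hz'B
    rw [hz'I, mem_secLow] at h1
    exact hgn (mem_secLow.2 ⟨sdiff_subset, h1.2⟩)

/-- (S1) signature of the target: `1`. [this work] -/
theorem sig_phi_S1 {x y : Finset ι} (hu : ((x, y), 0) ∈ ThreePartition.negUnitSetF S.B S.C) (hey : S.e ∈ y) :
    S.sig (S.phi ((x, y), 0)) = 1 := by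
  rw [phi_eq_S1 hu hey]
  exact S.sig_eq_1 rfl hey

/-- (S1) `φ` is injective on the class. [this work] -/
theorem inj_S1 {x₁ y₁ x₂ y₂ : Finset ι} (hu₁ : ((x₁, y₁), 0) ∈ ThreePartition.negUnitSetF S.B S.C) (hey₁ : S.e ∈ y₁)
    (hu₂ : ((x₂, y₂), 0) ∈ ThreePartition.negUnitSetF S.B S.C) (hey₂ : S.e ∈ y₂)
    (h : S.phi ((x₁, y₁), 0) = S.phi ((x₂, y₂), 0)) : ((x₁, y₁), 0) = ((x₂, y₂), 0) := by
  rw [phi_eq_S1 hu₁ hey₁, phi_eq_S1 hu₂ hey₂] at h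
  simp only [Prod.mk.injEq, and_true] at h
  obtain ⟨hx, rfl⟩ := h
  have hg₁I := (img_S1 hu₁ hey₁).1.trans sdiff_subset
  have hg₂I := (img_S1 hu₂ hey₂).1.trans sdiff_subset
  have hI : x₁ ∩ S.I = x₂ ∩ S.I :=
    congrArg Subtype.val ((S.dataI _).g₀.injective (Subtype.ext (nf_eq_nf_inter hg₁I hg₂I hx)))
  have hJ : x₁ ∩ S.J = x₂ ∩ S.J := nf_eq_nf_inter_other S.hIJ hg₁I hg₂I hx
  have hex₁ : S.e ∉ x₁ := fun he => disjoint_left.1 ((mem_negUnitSetF_iff _ _ _).1 hu₁).1 he hey₁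
  have hex₂ : S.e ∉ x₂ := fun he => disjoint_left.1 ((mem_negUnitSetF_iff _ _ _).1 hu₂).1 he hey₂
  rw [part_eq_of_traces (s := x₁) (s' := x₂) ⟨fun h => absurd h hex₁, fun h => absurd h hex₂⟩ hI hJ]

/-! ### Class (S2): `T2⁻` with `e ∈ y` -/

/-- (S2) domain: `x_J ∈ σP_w \ P_w` for `P_w = C⁰|_{J \ w}`, `w = y ∩ J`. [this work] -/
theorem dom_S2 {x y : Finset ι} (hu : ((x, y), 1) ∈ ThreePartition.negUnitSetF S.B S.C) (hey : S.e ∈ y) :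
    x ∩ S.J ∈ (secLow (S.J \ (y ∩ S.J)) S.C).image (fun t => (S.J \ (y ∩ S.J)) \ t) \ secLow (S.J \ (y ∩ S.J)) S.C := by
  rw [mem_negUnitSetF_iff] at hu
  obtain ⟨hxy, h⟩ := hu
  simp only at hxy h
  rcases h with ⟨h0, -⟩ | ⟨-, ⟨-, hxC⟩, hzC⟩ | ⟨h2, -⟩
  · exact absurd h0 (by norm_num)
  rotate_left
  · exact absurd h2 (by norm_num)
  have hex : S.e ∉ x := fun h => disjoint_left.1 hxy h hey
  have hxJR : x ∩ S.J ⊆ S.J \ (y ∩ S.J) := inter_subset_sdiff_inter hxy S.J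
  have hzJ : (x ∪ y)ᶜ ∩ S.J = (S.J \ (y ∩ S.J)) \ (x ∩ S.J) := compl_union_inter_eq x y S.J
  have hez : S.e ∉ (x ∪ y)ᶜ := by rw [mem_compl, not_not, mem_union]; exact Or.inr hey
  have hPR : ∀ s ∈ secLow (S.J \ (y ∩ S.J)) S.C, s ⊆ S.J \ (y ∩ S.J) := fun s hs => (mem_secLow.1 hs).1
  rw [mem_sdiff, mem_image_ground_sdiff _ hPR]
  refine ⟨⟨hxJR, ?_⟩, fun h => hxC ((mem_C_iff_secLow hex hxJR).2 h)⟩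
  rw [← hzJ]
  exact (mem_C_iff_secLow hez (hzJ ▸ sdiff_subset)).1 hzC

/-- (S2) the value of `φ`. [this work] -/
theorem phi_eq_S2 {x y : Finset ι} (hu : ((x, y), 1) ∈ ThreePartition.negUnitSetF S.B S.C) (hey : S.e ∈ y) :
    S.phi ((x, y), 1) = (((x \ S.J) ∪ ((S.dataJ (y ∩ S.J)).g₀ ⟨x ∩ S.J, dom_S2 hu hey⟩ : Finset ι), y), 1) := by
  unfold OneShared.phi
  simp only [hey, if_true, Nat.one_ne_zero, if_false]
  rw [dif_pos (dom_S2 hu hey)]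

/-- (S2) the new `J`-trace `g = h₀(x_J)` lies in `H(P_w)`; in particular `g ⊆ J \ w`. [this work] -/
theorem img_S2 {x y : Finset ι} (hu : ((x, y), 1) ∈ ThreePartition.negUnitSetF S.B S.C) (hey : S.e ∈ y) :
    ((S.dataJ (y ∩ S.J)).g₀ ⟨x ∩ S.J, dom_S2 hu hey⟩ : Finset ι) ⊆ S.J \ (y ∩ S.J) ∧
      ((S.dataJ (y ∩ S.J)).g₀ ⟨x ∩ S.J, dom_S2 hu hey⟩ : Finset ι) ∈ S.C ∧
      (S.J \ (y ∩ S.J)) \ ((S.dataJ (y ∩ S.J)).g₀ ⟨x ∩ S.J, dom_S2 hu hey⟩ : Finset ι) ∉ secLow (S.J \ (y ∩ S.J)) S.C := by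
  have hPR : ∀ s ∈ secLow (S.J \ (y ∩ S.J)) S.C, s ⊆ S.J \ (y ∩ S.J) := fun s hs => (mem_secLow.1 hs).1
  have hgmem := ((S.dataJ (y ∩ S.J)).g₀ ⟨x ∩ S.J, dom_S2 hu hey⟩).2
  rw [mem_sdiff, mem_image_ground_sdiff _ hPR, mem_secLow] at hgmem
  obtain ⟨⟨hgR, hgC⟩, hgn⟩ := hgmem
  exact ⟨hgR, hgC, fun h => hgn ⟨hgR, h⟩⟩

/-- **Class (S2)**: `φ` sends a `T2⁻` unit with `e ∈ y` to the `T2⁺` unit at `(x_I ∪ h₀(x_J), y)`. [this work] -/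
theorem phi_adm_S2 {x y : Finset ι} (hu : ((x, y), 1) ∈ ThreePartition.negUnitSetF S.B S.C) (hey : S.e ∈ y) :
    S.phi ((x, y), 1) ∈ ThreePartition.posUnitSetF S.B S.C ∧ x ⊆ (S.phi ((x, y), 1)).1.1 ∧ y ⊆ (S.phi ((x, y), 1)).1.2 := by
  obtain ⟨hgR, hgC, hgn⟩ := img_S2 hu hey
  have hgdom : x ∩ S.J ⊆ ((S.dataJ (y ∩ S.J)).g₀ ⟨x ∩ S.J, dom_S2 hu hey⟩ : Finset ι) :=
    (S.dataJ (y ∩ S.J)).hg₀ ⟨x ∩ S.J, dom_S2 hu hey⟩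
  rw [phi_eq_S2 hu hey]
  set g := ((S.dataJ (y ∩ S.J)).g₀ ⟨x ∩ S.J, dom_S2 hu hey⟩ : Finset ι) with hg
  rw [mem_negUnitSetF_iff] at hu
  obtain ⟨hxy, h⟩ := hu
  simp only at hxy h
  rcases h with ⟨h0, -⟩ | ⟨-, ⟨hxB, -⟩, -⟩ | ⟨h2, -⟩
  · exact absurd h0 (by norm_num)
  rotate_left
  · exact absurd h2 (by norm_num)
  have hex : S.e ∉ x := fun h => disjoint_left.1 hxy h hey
  have hgJ : g ⊆ S.J := hgR.trans sdiff_subset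
  have hex' : S.e ∉ (x \ S.J) ∪ g := fun h => hex ((nf_mem_iff S.heJ hgJ).1 h)
  have hdisj' : Disjoint ((x \ S.J) ∪ g) y := nf_disjoint hxy hgR
  have hez' : S.e ∉ (((x \ S.J) ∪ g) ∪ y)ᶜ := by rw [mem_compl, not_not, mem_union]; exact Or.inr hey
  rw [mem_posUnitSetF_iff]
  refine ⟨⟨hdisj', Or.inr (Or.inl ⟨rfl, ⟨?_, ?_⟩, ?_⟩)⟩, nf_subset hgdom, subset_rfl⟩
  · -- `x' ∈ B`: same `I`-trace
    have hxI : x ∩ S.I ∈ secLow (S.I \ (y ∩ S.I)) S.B :=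
      (mem_B_iff_secLow hex (inter_subset_sdiff_inter hxy S.I)).1 hxB
    refine (mem_B_iff_secLow hex' (inter_subset_sdiff_inter hdisj' S.I)).2 ?_
    rw [nf_inter_other S.hIJ.symm hgJ]; exact hxI
  · -- `x' ∈ C`
    refine (mem_C_iff_secLow (R := S.J \ (y ∩ S.J)) hex' ?_).2 ?_
    · rw [nf_inter hgJ]; exact hgR
    · rw [nf_inter hgJ]; exact mem_secLow.2 ⟨hgR, hgC⟩
  · -- `z' ∉ C`
    intro hz'C
    have hz'J : (((x \ S.J) ∪ g) ∪ y)ᶜ ∩ S.J = (S.J \ (y ∩ S.J)) \ g := nf_compl_inter hgJ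
    have h1 := (mem_C_iff_secLow hez' (hz'J ▸ sdiff_subset)).1 hz'C
    rw [hz'J, mem_secLow] at h1
    exact hgn (mem_secLow.2 ⟨sdiff_subset, h1.2⟩)

/-- (S2) signature of the target: `2`. [this work] -/
theorem sig_phi_S2 {x y : Finset ι} (hu : ((x, y), 1) ∈ ThreePartition.negUnitSetF S.B S.C) (hey : S.e ∈ y) :
    S.sig (S.phi ((x, y), 1)) = 2 := by
  rw [phi_eq_S2 hu hey]
  exact S.sig_eq_2 rfl hey

/-- (S2) `φ` is injective on the class. [this work] -/
theorem inj_S2 {x₁ y₁ x₂ y₂ : Finset ι} (hu₁ : ((x₁, y₁), 1) ∈ ThreePartition.negUnitSetF S.B S.C) (hey₁ : S.e ∈ y₁)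
    (hu₂ : ((x₂, y₂), 1) ∈ ThreePartition.negUnitSetF S.B S.C) (hey₂ : S.e ∈ y₂)
    (h : S.phi ((x₁, y₁), 1) = S.phi ((x₂, y₂), 1)) : ((x₁, y₁), 1) = ((x₂, y₂), 1) := by
  rw [phi_eq_S2 hu₁ hey₁, phi_eq_S2 hu₂ hey₂] at h
  simp only [Prod.mk.injEq, and_true] at h
  obtain ⟨hx, rfl⟩ := h
  have hg₁J := (img_S2 hu₁ hey₁).1.trans sdiff_subset
  have hg₂J := (img_S2 hu₂ hey₂).1.trans sdiff_subset
  have hJ : x₁ ∩ S.J = x₂ ∩ S.J :=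
    congrArg Subtype.val ((S.dataJ _).g₀.injective (Subtype.ext (nf_eq_nf_inter hg₁J hg₂J hx)))
  have hI : x₁ ∩ S.I = x₂ ∩ S.I := nf_eq_nf_inter_other S.hIJ.symm hg₁J hg₂J hx
  have hex₁ : S.e ∉ x₁ := fun he => disjoint_left.1 ((mem_negUnitSetF_iff _ _ _).1 hu₁).1 he hey₁
  have hex₂ : S.e ∉ x₂ := fun he => disjoint_left.1 ((mem_negUnitSetF_iff _ _ _).1 hu₂).1 he hey₂
  rw [part_eq_of_traces (s := x₁) (s' := x₂) ⟨fun h => absurd h hex₁, fun h => absurd h hex₂⟩ hI hJ]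

end OneShared

end SahiFComb.Shift

end Summit.CriticalPhenomena.PercolationContinuityZ3.Theorems
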